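import Mathlib
import Summits.PneNP.PneNP.Theorems.PstarGapGadget
import Summits.PneNP.PneNP.Theorems.PstarGapLemma

/-!
# The gap lemma NEEDS boundary expansion: free cycle closings are load-bearing without it (ROUND-24 item T24.8f)

FRONTIER range-avoidance ladder (cell `pnp-ideate`, ROUND-24 gap-lemma programme; restricted-model combinatorics — nothing here bears
on `P` versus `NP`).

**Theorem** `gapLemmaSO_false_without_expanding`: the simple-overlap gap lemma WITHOUT the hypothesis `BoundaryExpanding r I` is false:
`¬ (∀ Δ, ∃ K > 0, ∀ n m r I, pure → Typed → SimpleOverlap → MaxDegree Δ → ∀ y, GapBound K r I y)`.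
Witness at `Δ = 3`: `N = K + 1` disjoint copies of the gadget `𝔊` of `PstarGapGadget` (AND graph `K_{3,3}`, XOR graph the Hamiltonian
nine-cycle; pure, typed, simple overlaps, degree `3`; `n = 15N`, `m = 9N`), targets `y = e₀` on every copy, and the ONE parity constraint
`Σ_i (p₀⁽ⁱ⁾+p₁⁽ⁱ⁾+p₂⁽ⁱ⁾) = N + 1 (mod 2)`.  Every assignment satisfying all outputs of a copy has `P_i = 1` (the free cycle closing reads
`P_i Q_i = 1`), so `J = univ` is infeasible; erasing output `(i₀, t₀)` opens copy `i₀`'s cycle (`zdel t₀`: `P_{i₀} = 0`, the other eight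
outputs hold) while the other copies take `zfull` (`P = 1`), giving `Σ P = N − 1 ≡ N + 1`: `univ` is MINIMAL infeasible with `#W = 1`,
`#J = 9N > K`.  The gadget has empty boundary on every copy, so this is excluded by `BoundaryExpanding r` for `r ≥ 9` — it is the
record that any proof of `PstarGapLemma.PstarGapLemmaSO` must use expansion on the cyclic part of the XOR graph.
-/

set_option linter.dupNamespace false -- `Summit.PneNP.PneNP.…`: summit = sub-problem name (D-0017 single-conjunct layout)

open Finset Literature.Computability.Complexity
open Summit.PneNP.PneNP.Theorems.PstarPDT (parity)
open Summit.PneNP.PneNP.Theorems.PstarTyped (Typed)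
open Summit.PneNP.PneNP.Theorems.PstarSALevel (varSet SimpleOverlap)
open Summit.PneNP.PneNP.Theorems.PstarGapLemma (Sat Feasible MinInfeasible GapBound MaxDegree sat_empty)
open Summit.PneNP.PneNP.Theorems.PstarGraphQuadGapInstance (bpar bpar_union bpar_insert bpar_singleton bpar_congr bpar_map
  parity_eq_bpar decide_odd_add)
open Summit.PneNP.PneNP.Theorems.PstarGapGadget

namespace Summit.PneNP.PneNP.Theorems.PstarGapNeedsExpansion

/-! ## `N` disjoint copies -/

section Copies

variable (N : ℕ)

/-- Variable `l` of copy `i`. -/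
def emb (i : Fin N) (l : Fin 15) : Fin (N * 15) := finProdFinEquiv (i, l)

/-- `emb` is jointly injective. -/
theorem emb_inj {i i' : Fin N} {l l' : Fin 15} (h : emb N i l = emb N i' l') : i = i' ∧ l = l' := by
  have := finProdFinEquiv.injective h
  exact ⟨(Prod.ext_iff.1 this).1, (Prod.ext_iff.1 this).2⟩

/-- Copy and local index of an output. -/
def out (j : Fin (N * 9)) : Fin N × Fin 9 := finProdFinEquiv.symm j

/-- The output of copy `i` with local index `t`. -/
def outOf (i : Fin N) (t : Fin 9) : Fin (N * 9) := finProdFinEquiv (i, t)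

/-- `out (outOf i t) = (i, t)`. -/
theorem out_outOf (i : Fin N) (t : Fin 9) : out N (outOf N i t) = (i, t) := by simp [out, outOf]

/-- **The `N`-fold gadget instance.** -/
def gadN : LocalMap 4 (N * 15) (N * 9) where
  vars j s := emb N (out N j).1 (loc (out N j).2 s)
  table _ := xorAndPred

/-- Pure `P⋆`. -/
theorem isPure_gadN : (gadN N).IsPure xorAndPred :=
  ⟨fun _ => rfl, fun _ _ _ h => loc_injective _ (emb_inj N h).2⟩

/-- Typed. -/
theorem typed_gadN : Typed (gadN N) :=
  fun _ _ s s' hs hs' h => loc_typed _ _ s s' hs hs' (emb_inj N h).2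

/-- The variable set of an output is the embedded local variable set. -/
theorem varSet_gadN (j : Fin (N * 9)) : varSet (gadN N) j = (vs (out N j).2).image (emb N (out N j).1) := by
  unfold PstarSALevel.varSet PstarGapGadget.vs
  rw [image_image]
  rfl

/-- Simple overlaps. -/
theorem simpleOverlap_gadN : SimpleOverlap (gadN N) := by
  intro j j' hne
  rw [varSet_gadN, varSet_gadN]
  by_cases hi : (out N j).1 = (out N j').1
  · have ht : (out N j).2 ≠ (out N j').2 := fun h => hne (by
      have : out N j = out N j' := Prod.ext hi h
      exact finProdFinEquiv.symm.injective this)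
    rw [hi, ← image_inter _ _ (fun l l' h => (emb_inj N h).2), card_image_of_injective _ (fun l l' h => (emb_inj N h).2)]
    exact vs_inter_card_le _ _ ht
  · have h0 : (vs (out N j).2).image (emb N (out N j).1) ∩ (vs (out N j').2).image (emb N (out N j').1) = ∅ := by
      rw [← disjoint_iff_inter_eq_empty, disjoint_left]
      intro v hv hv'
      obtain ⟨l, -, rfl⟩ := mem_image.1 hv
      obtain ⟨l', -, h⟩ := mem_image.1 hv'
      exact hi (emb_inj N h).1.symm
    rw [h0, card_empty]
    exact Nat.zero_le _

/-- Maximum degree three. -/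
theorem maxDegree_gadN : MaxDegree 3 (gadN N) := by
  intro v
  obtain ⟨⟨i, l⟩, rfl⟩ : ∃ il : Fin N × Fin 15, v = emb N il.1 il.2 :=
    ⟨finProdFinEquiv.symm v, by unfold emb; rw [Prod.mk.eta]; exact (finProdFinEquiv.apply_symm_apply v).symm⟩
  have hsub : (univ.filter fun j : Fin (N * 9) => emb N i l ∈ varSet (gadN N) j) ⊆
      (univ.filter fun t : Fin 9 => l ∈ vs t).image (outOf N i) := by
    intro j hj
    rw [mem_filter, varSet_gadN, mem_image] at hj
    obtain ⟨l', hl', he⟩ := hj.2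
    obtain ⟨hi, hl⟩ := emb_inj N he
    rw [mem_image]
    refine ⟨(out N j).2, mem_filter.2 ⟨mem_univ _, hl ▸ hl'⟩, ?_⟩
    have : outOf N (out N j).1 (out N j).2 = j := by
      unfold out outOf; rw [Prod.mk.eta]; exact finProdFinEquiv.apply_symm_apply j
    rw [hi] at this
    exact this
  exact (card_le_card hsub).trans (card_image_le.trans (degree_le_three l))

/-! ## Semantics -/

/-- The local assignment of copy `i`. -/
def zc (z : Fin (N * 15) → Bool) (i : Fin N) : Fin 15 → Bool := fun l => z (emb N i l)

/-- The value of output `(i, t)` is the local value. -/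
theorem eval_gadN (z : Fin (N * 15) → Bool) (j : Fin (N * 9)) :
    (gadN N).eval z j = evalL (zc N z (out N j).1) (out N j).2 := rfl

/-- The targets: `e₀` on every copy. -/
def yN (j : Fin (N * 9)) : Bool := y1 (out N j).2

/-- The `p`-variables of all copies. -/
def pset : Finset (Fin (N * 15)) :=
  (univ : Finset (Fin N × Fin 3)).map ⟨fun ik => emb N ik.1 (pv ik.2), fun ik ik' h => by
    obtain ⟨h1, h2⟩ := emb_inj N h
    exact Prod.ext h1 (by have := congrArg Fin.val h2; simp [pv] at this; exact Fin.ext this)⟩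

/-- The parity of `pset` is `⊕_i P_i`. -/
theorem parity_pset (z : Fin (N * 15) → Bool) :
    parity (pset N) z = bpar (univ : Finset (Fin N)) (fun i => ploc (zc N z i)) := by
  rw [parity_eq_bpar, pset, bpar_map, ← univ_product_univ, bpar_product]
  rfl

/-- The single parity constraint `Σ_i P_i = ¬ parity(N)` (i.e. `≡ N + 1`). -/
def W1 : Finset (Finset (Fin (N * 15)) × Bool) := {(pset N, !decide (Odd N))}

/-- **`univ` is infeasible**: all outputs of a copy force `P_i = 1`, so `Σ_i P_i ≡ N`. -/
theorem not_feasible_univ : ¬ Feasible (gadN N) (yN N) (W1 N) univ := by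
  rintro ⟨z, hsat, hall⟩
  have hP : ∀ i, ploc (zc N z i) = true := fun i =>
    ploc_of_all _ fun t => by
      have h := hall (outOf N i t) (mem_univ _)
      rw [eval_gadN, yN, out_outOf] at h
      exact h
  have hpar := hsat (pset N, !decide (Odd N)) (by simp [W1])
  change parity (pset N) z = !decide (Odd N) at hpar
  rw [parity_pset, bpar_congr (fun i _ => hP i), bpar_true, card_univ, Fintype.card_fin] at hpar
  revert hpar
  cases decide (Odd N) <;> decide

/-- **Every output is necessary**: deleting `(i₀, t₀)` lets copy `i₀` take `P = 0`. -/
theorem feasible_erase (j₀ : Fin (N * 9)) : Feasible (gadN N) (yN N) (W1 N) (univ.erase j₀) := by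
  set i₀ := (out N j₀).1 with hi₀
  set t₀ := (out N j₀).2 with ht₀
  let z : Fin (N * 15) → Bool := fun v =>
    if (finProdFinEquiv.symm v).1 = i₀ then zdel t₀ (finProdFinEquiv.symm v).2 else zfull (finProdFinEquiv.symm v).2
  have hzc : ∀ i, zc N z i = if i = i₀ then zdel t₀ else zfull := by
    intro i
    funext l
    simp only [zc, z, emb, Equiv.symm_apply_apply]
    split_ifs <;> rfl
  refine ⟨z, ?_, ?_⟩
  · -- the parity constraint: `Σ_i P_i = #{i ≠ i₀} ≡ N − 1 ≡ N + 1`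
    intro e he
    rw [W1, mem_singleton] at he
    subst he
    change parity (pset N) z = !decide (Odd N)
    rw [parity_pset, bpar_congr (fun i _ => by rw [hzc i])]
    have hval : ∀ i : Fin N, ploc (if i = i₀ then zdel t₀ else zfull) = decide (i ≠ i₀) := by
      intro i
      by_cases h : i = i₀
      · rw [if_pos h, ploc_zdel]; simp [h]
      · rw [if_neg h, ploc_zfull]; simp [h]
    rw [bpar_congr (fun i _ => hval i)]
    unfold bpar
    have hc : (univ.filter fun i : Fin N => decide (i ≠ i₀) = true) = univ.erase i₀ := by
      ext i; simp [mem_erase]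
    rw [hc, card_erase_of_mem (mem_univ _), card_univ, Fintype.card_fin]
    have hN : 1 ≤ N := by
      have := i₀.isLt; omega
    have h2 := decide_odd_add (N - 1) 1
    rw [Nat.sub_add_cancel hN] at h2
    rw [h2]
    cases decide (Odd (N - 1)) <;> decide
  · -- all other outputs hold
    intro j hj
    have hne : j ≠ j₀ := ne_of_mem_erase hj
    rw [eval_gadN, yN, hzc]
    by_cases hi : (out N j).1 = i₀
    · rw [if_pos hi]
      apply evalL_zdel
      intro ht
      apply hne
      apply finProdFinEquiv.symm.injective
      change out N j = out N j₀
      exact Prod.ext hi ht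
    · rw [if_neg hi]
      exact evalL_zfull _

/-- **`univ` is a minimal infeasible set for the one-constraint system `W1`.** -/
theorem minInfeasible_univ : MinInfeasible (gadN N) (yN N) (W1 N) univ :=
  ⟨not_feasible_univ N, fun j₀ _ => feasible_erase N j₀⟩

end Copies

/-! ## The theorem -/

/-- **T24.8f — the simple-overlap gap lemma is FALSE without boundary expansion.**  (At `Δ = 3`: for the purported `K`, the
`(K+1)`-fold gadget has the minimal infeasible set `univ` of size `9(K+1) > K·1`.)  Restricted-model negative result of the
range-avoidance ladder; it says nothing about `P` versus `NP`. -/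
theorem gapLemmaSO_false_without_expanding :
    ¬ (∀ Δ : ℕ, ∃ K : ℕ, 0 < K ∧ ∀ (n m r : ℕ) (I : LocalMap 4 n m), I.IsPure xorAndPred → Typed I →
        SimpleOverlap I → MaxDegree Δ I → ∀ y : Fin m → Bool, GapBound K r I y) := by
  intro h
  obtain ⟨K, -, hK⟩ := h 3
  set N := K + 1 with hN
  have hG := hK _ _ (N * 9) (gadN N) (isPure_gadN N) (typed_gadN N) (simpleOverlap_gadN N) (maxDegree_gadN N) (yN N)
  have hle := hG (W1 N) univ (by rw [card_univ, Fintype.card_fin]) (minInfeasible_univ N)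
  rw [card_univ, Fintype.card_fin, W1, card_singleton, mul_one] at hle
  omega

end Summit.PneNP.PneNP.Theorems.PstarGapNeedsExpansion
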